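import Mathlib
import Summits.KontsevichZagierPeriods.Zeta5Search.CasoratianClassBoundPal
import HarnessLib

/-!
# ζ(5) search — THEOREM LB♯ with the `V`-bounds as hypotheses: the palindromic `𝒦`-row bonus for the V-GAIN glue (DENOM-LAW D1, prover-d1 gen 19)

HONEST FRAMING: systematic search; no irrationality claim unless certified.  Cell `pub-zeta5`, track «DENOM-LAW» D1, seat `denom-prover-d1`
gen 19 (`HOME/denom-law/prover-d1/ATTEMPT-19.md` §7).  `p`-adic valuation bookkeeping of the explicit rationals `Cas_j(b)`; nothing about ζ(5); no γ;
records in print UNMOVED.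

`cas_val_ge_of_coeffV_pal` = `casoratian_bound_pal` (THEOREM LB♯) with the bounds `‖V(b)‖, ‖V(b+e_j)‖ ≤ p^{−v}` taken as HYPOTHESES instead of
`v ≤ ν_y` class by class — the palindromic-row version of `VCarrierAggregate.cas_val_ge_of_coeffV` (whose multipole rows are `3 + E_x`).  USE (the
census's rung VGP): the V-gain of a cancelling palindromic carrier pair (`padicNorm_coeffV_le_of_carriers`, v = VB + 1, for `b` and `b + e₇`) combined
with the row `4 + E` of the deep palindromic pair `[−2,−2]` / `[1,−3,−3,1]` at `m = −4` = the «s = 2» remainder of the census's configuration (i)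
(a non-tame single pair at `ν = −6` BELOW the deep pair, e.g. `b = (35;17,17,17,17,6,3,0)`, `p = 17`, `v₁₇(Cas₇) = −5 = (−6 + 1) + 0`): exact check
0 port violations / 54,713 (p ≤ 7); closes 57 of the 992 instances left open at p ≤ 7 after A‴₄ and LB♯.
-/

noncomputable section

open Finset

namespace Summit.KontsevichZagierPeriods.Zeta5Search.ClusterValuation

open Summit.KontsevichZagierPeriods.Zeta5Search.DualSeries (InBox)
open Summit.KontsevichZagierPeriods.Zeta5Search.WedgeDictionary (coeffV dOf)
open Summit.KontsevichZagierPeriods.Zeta5Search.CasoratianValuation (InPolytope shift casoratian)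
open Summit.KontsevichZagierPeriods.Zeta5Search.PadicSeries
open Summit.KontsevichZagierPeriods.Zeta5Search.BigPrime (shift_zero dOf_shift)

variable {p : ℕ}

/-- **THEOREM LB♯ with the `V`-bounds as hypotheses** (the palindromic-row version of `VCarrierAggregate.cas_val_ge_of_coeffV`): window prime
`5 ≤ p ≤ b₀ < p² − 2`, `b` and `b + e_j` in the polytope; `‖V(b)‖, ‖V(b + e_j)‖ ≤ p^{−v}` (e.g. from `padicNorm_coeffV_le_of_carriers`, the V-gain of a
cancelling carrier pair); `r ≤ 1` on single-pole rows; for every multipole class `x` either `r ≤ 3 + E_x`, or `x` is palindromic with `E_x ≤ −3`,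
`3 + E_x` odd and `r ≤ 4 + E_x`; `r ≤ 0` if `d < p`.  Then `v + r ≤ v_p(Cas_j(b))`. -/
theorem cas_val_ge_of_coeffV_pal (b : ℕ → ℤ) (j p : ℕ) (hb : InPolytope b) (hj1 : 1 ≤ j) (hj7 : j ≤ 7) (hb' : InPolytope (shift b j))
    (hprime : p.Prime) (hp5 : 5 ≤ p) (hpb : (p : ℤ) ≤ b 0) (hwin : (b 0 + 2 : ℤ) < (p : ℤ) ^ 2) (v r : ℤ)
    (hVb : padicNorm p (coeffV b) ≤ (p : ℚ) ^ (-v)) (hVb' : padicNorm p (coeffV (shift b j)) ≤ (p : ℚ) ^ (-v))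
    (hr1 : ∀ x, x < p → classPoleCount b p x = 1 → r ≤ 1)
    (hrm : ∀ x, x < p → 2 ≤ classPoleCount b p x →
      r ≤ 3 + classExp b p x ∨
        (classExp b p x ≤ -3 ∧ IsPalindromic (classConfig b p x) ∧ Odd (3 + classExp b p x) ∧ r ≤ 4 + classExp b p x))
    (hr0 : dOf b < (p : ℤ) → r ≤ 0)
    (hcas : casoratian b j ≠ 0) : v + r ≤ padicValRat p (casoratian b j) := by
  haveI : Fact p.Prime := ⟨hprime⟩
  have hp1 : (1 : ℚ) ≤ p := one_le_p
  have h0' : shift b j 0 = b 0 := shift_zero b hj1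
  have hwin' : (shift b j 0 + 2 : ℤ) < (p : ℤ) ^ 2 := by rw [h0']; exact hwin
  have hpb' : (p : ℤ) ≤ shift b j 0 := by rw [h0']; exact hpb
  have hbox : InBox b := hb.1
  have hcnt : ∀ x, classPoleCount (shift b j) p x ≤ classPoleCount b p x :=
    fun x => classPoleCount_shift_le b hbox hj1 p x
  -- the rows
  have hrow : ∀ x ∈ range p,
      padicNorm p (classK (shift b j) p x * coeffV b - classK b p x * coeffV (shift b j)) ≤ (p : ℚ) ^ (-(v + r)) := by
    intro x hx
    have hx' := mem_range.1 hx
    rcases Nat.lt_trichotomy (classPoleCount b p x) 1 with hc | hc | hc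
    · have h0 : classPoleCount b p x = 0 := by omega
      have h0s : classPoleCount (shift b j) p x = 0 := by have := hcnt x; omega
      rw [classK_eq_zero_of_noPole b hb h0, classK_eq_zero_of_noPole _ hb' h0s, zero_mul, zero_mul, sub_zero,
        padicNorm.zero]
      exact zpow_p_nonneg _
    · have hr1' : r ≤ 1 := hr1 x hx' hc
      have hK : padicNorm p (classK b p x) ≤ (p : ℚ) ^ (-(1 : ℤ)) := padicNorm_classK_le_single b hb hp5 hwin hx' hc
      have hK' : padicNorm p (classK (shift b j) p x) ≤ (p : ℚ) ^ (-(1 : ℤ)) := by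
        rcases Nat.eq_zero_or_pos (classPoleCount (shift b j) p x) with h0s | hpos
        · rw [classK_eq_zero_of_noPole _ hb' h0s, padicNorm.zero]; exact zpow_p_nonneg _
        · exact padicNorm_classK_le_single _ hb' hp5 hwin' hx' (by have := hcnt x; omega)
      refine (padicNorm.sub (p := p)).trans (max_le ?_ ?_)
      · exact (padicNorm_mul_le hK' hVb).trans (zpow_le_zpow_right₀ hp1 (by linarith))
      · exact (padicNorm_mul_le hK hVb').trans (zpow_le_zpow_right₀ hp1 (by linarith))
    · -- a multipole class of `b`: the row exponent `e` with `r ≤ e` and `‖𝒦_x‖, ‖𝒦⁺_x‖ ≤ p^{-e}`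
      have h2 : 2 ≤ classPoleCount b p x := by omega
      obtain ⟨e, hre, hK, hK'⟩ : ∃ e : ℤ, r ≤ e ∧ padicNorm p (classK b p x) ≤ (p : ℚ) ^ (-e) ∧
          padicNorm p (classK (shift b j) p x) ≤ (p : ℚ) ^ (-e) := by
        have hKs : padicNorm p (classK (shift b j) p x) ≤ (p : ℚ) ^ (-(3 + classExp (shift b j) p x)) := by
          rcases Nat.eq_zero_or_pos (classPoleCount (shift b j) p x) with h0s | hpos
          · rw [classK_eq_zero_of_noPole _ hb' h0s, padicNorm.zero]; exact zpow_p_nonneg _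
          · exact padicNorm_classK_le_multi _ hb' hp5 hwin' hx' hpos
        have hge := classExp_shift_ge b hbox hj1 p x
        rcases hrm x hx' h2 with hr3 | ⟨hE3, hpal, hodd, hr4⟩
        · exact ⟨3 + classExp b p x, hr3, padicNorm_classK_le_multi b hb hp5 hwin hx' (by omega),
            hKs.trans (zpow_le_zpow_right₀ hp1 (by linarith))⟩
        · refine ⟨4 + classExp b p x, hr4, padicNorm_classK_le_pal_four b hb hp5 hpb hwin hx' h2 hE3 hpal hodd, ?_⟩
          by_cases heq : classExp (shift b j) p x = classExp b p x
          · -- unhit: the class of `b + e_j` is the same palindromic multipole class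
            have h2s : 2 ≤ classPoleCount (shift b j) p x := by
              rw [classPoleCount_shift_of_classExp_eq b hbox hj1 heq]; exact h2
            have h := padicNorm_classK_le_pal_four (shift b j) hb' hp5 hpb' hwin' hx' h2s (by omega)
              (by rw [classConfig_shift_of_classExp_eq b hb hb' hj1 hj7 heq]; exact hpal) (by rw [heq]; exact hodd)
            rw [heq] at h
            exact h
          · -- hit: the exponent went up
            by_cases h1s : classPoleCount (shift b j) p x = 1
            · exact (padicNorm_classK_le_single _ hb' hp5 hwin' hx' h1s).trans (zpow_le_zpow_right₀ hp1 (by omega))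
            · exact hKs.trans (zpow_le_zpow_right₀ hp1 (by omega))
      refine (padicNorm.sub (p := p)).trans (max_le ?_ ?_)
      · exact (padicNorm_mul_le hK' hVb).trans (zpow_le_zpow_right₀ hp1 (by linarith))
      · exact (padicNorm_mul_le hK hVb').trans (zpow_le_zpow_right₀ hp1 (by linarith))
  have hB : padicNorm p (kRes (shift b j) p * coeffV b - kRes b p * coeffV (shift b j)) ≤ (p : ℚ) ^ (-(v + r)) := by
    rw [kRes_eq_sum_classK (shift b j) hprime.pos, kRes_eq_sum_classK b hprime.pos, sum_mul, sum_mul,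
      ← sum_sub_distrib]
    exact padicNorm.sum_le' hrow (zpow_p_nonneg _)
  -- the Ω-bracket and the assembly (verbatim from THEOREM LB)
  apply val_ge_of_padicNorm_le hcas
  rw [casoratian_split b j p]
  have hdshift : dOf (shift b j) = dOf b - 1 := dOf_shift b hj1 hj7
  by_cases hpd : (p : ℤ) ≤ dOf b
  · rw [omegaRes_eq_zero b hb (by omega), omegaRes_eq_zero (shift b j) hb' (by rw [hdshift]; omega), zero_mul,
      zero_mul, sub_zero, zero_sub, padicNorm.neg]
    exact hB
  · have hr0' : r ≤ 0 := hr0 (by push Not at hpd; exact hpd)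
    refine (padicNorm.sub (p := p)).trans (max_le ?_ hB)
    refine (padicNorm.sub (p := p)).trans (max_le ?_ ?_)
    · have h1 : padicNorm p (omegaRes (shift b j) p) ≤ (p : ℚ) ^ (0 : ℤ) := by
        simpa using padicNorm_omegaRes_le_one (shift b j) hb' (by omega)
      exact (padicNorm_mul_le h1 hVb).trans (zpow_le_zpow_right₀ hp1 (by linarith))
    · have h1 : padicNorm p (omegaRes b p) ≤ (p : ℚ) ^ (0 : ℤ) := by
        simpa using padicNorm_omegaRes_le_one b hb (by omega)
      exact (padicNorm_mul_le h1 hVb').trans (zpow_le_zpow_right₀ hp1 (by linarith))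

end Summit.KontsevichZagierPeriods.Zeta5Search.ClusterValuation

end
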